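import Literature.AnabelianGeometry.SemiGraphs.ArithLevelKernelInnerCharTower
import HarnessLib

/-!
# [SemiAnbd] Thm 5.4 (i) p. 66, producer T54-B: «hUρ» at the characteristic tower for `𝒢` with a vertex
# carrying two distinct branches — the branch-pair system SUPPLIED (proof-only)

Mochizuki, *Semi-graphs of anabelioids*, Publ. RIMS **42** (2006), §3 Thm 3.7 (i)/(iii) pp. 40–41, §5
Thm 5.4 (i) p. 66 [cite: MochizukiSemiAnbd2006, Thm 5.4 (i) p.66].

PROOF-ONLY sequel of `ArithLevelKernelInnerCharTower.lean` (abc-iut cell, layer L3, row T54-B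
«char-tower hR/hnobp», seat abc-iut-w4-d085 gen 5).  There, Corollary D («hUρ»: `U_∞ ≤ ker ρ′` at
`π₁^temp(𝒢) ⋊^out Π_A`) was made a theorem of tower data modulo the branch-pair test `hnobpNCpt` and ONE
compatible system of a vertex with two distinct abutting branches of the finite coset levels.  Here:

* `SemiGraph.SubgroupPresentation.eq_bot_of_isCompact_of_forall_deckAct_eq_one_of_two_branches` — the
  system is SUPPLIED by any vertex `v` of `𝔾` with two distinct branches `b ≠ b′` abutting it:
  `w_i := H_v·1·L_i`, `β_i := [b, (s b)⁻¹]`, `β′_i := [b′, (s b′)⁻¹]` (compatible by `rfl` on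
  representatives, `cosetGraph_abuts_bMk`), so `hnobpNCpt ⇒ hnobp` outright for such `𝔾`;
* `GaloisLevelData.mem_ker_of_mem_iInf_map_ker_arithAct_chart_outerAction_of_two_branches` — «hUρ» at the
  chart of any cofinal Galois tower with characteristic (`hker`) and vertex-faithful (`hfaithV`, (I0v))
  levels, `hnobpNCpt :=` abc-iut-w4-d053's `hnobpNCpt_cosetTower_of_faithV_chart`;
* `GaloisLevelData.ofCharCores_mem_ker_of_mem_iInf_map_ker_arithAct_outerAction` — **«hUρ» AT
  abc-iut-w4-d048's CHARACTERISTIC tower with every tower input a term** (`hker :=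
  ofCharCores_ker_piLevelAut_eq_charOpenCore`, abc-iut-w4-d029; `hfaithV := faithfulV_ofCharCores`,
  abc-iut-w4-d053): residual = the presentation's compatibility/stability binders `hP`/`hN` (terms of
  record at the design data) and the two branches at one vertex.

HONEST FRAME: for a one-vertex EDGELESS `𝒢` the statement «hUρ» is false unless `ρ′ = 1` (abc-iut-w4-d071,
ArithLevelKernelEdgelessObstruction.lean); a vertex with two distinct branches is the combinatorial input
used here (a single closed edge between two distinct vertices is NOT covered by this file).  No
definition, no new named fact; nothing here refers to the IUT corpus; no side is taken on [IUTchIII]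
Cor 3.12; typed ≠ proved for the inputs left as binders.
-/

namespace Literature.AnabelianGeometry.SemiGraphs

open CategoryTheory Topology Filter
open scoped Pointwise

universe u v

namespace SemiGraph

namespace SubgroupPresentation

variable {𝔾 : SemiGraph.{u}} {Γ : Type u} [Group Γ] [TopologicalSpace Γ]
  (P : SubgroupPresentation 𝔾 Γ)

/-- **`hnobp ⟸ hnobpNCpt` whenever `𝔾` has a vertex with two distinct abutting branches.** The system
`w_i := H_v·1·L_i`, `β_i := [b, M_e (s b)⁻¹ L_i]`, `β′_i := [b′, M_{e′} (s b′)⁻¹ L_i]` (`b ≠ b′` both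
abutting `v`) is a compatible system of a vertex with two distinct abutting branches of the finite coset
levels (transitions act by `rfl` on representatives), so the branch-pair test `hnobpNCpt` yields `hnobp`:
every compact subgroup of `Γ` acting trivially on all finite coset levels is trivial.
[cite: MochizukiSemiAnbd2006, Thm 5.4 (i) p.66] -/
theorem eq_bot_of_isCompact_of_forall_deckAct_eq_one_of_two_branches
    (L : ℕ → Subgroup Γ) [∀ n, (L n).Normal] (hLanti : ∀ ⦃i j : ℕ⦄, i ≤ j → L j ≤ L i)
    {E : Type v} [Group E] {Φ : E →* MulAut Γ} {σ : E →* Aut 𝔾} (hP : P.IsArithCompatible Φ σ)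
    (hLst : ∀ (n : ℕ) (e : E) (x : Γ), x ∈ L n → Φ e x ∈ L n)
    (ι : Γ →* E) (hιΦ : ∀ g, Φ (ι g) = MulAut.conj g) (hισ : ∀ g, σ (ι g) = 1)
    (hnobpNCpt : ∀ (C : Subgroup Γ), IsCompact (C : Set Γ) →
      ∀ (j₀ : ℕ) (w : ∀ i : {i : ℕ // j₀ ≤ i}, (P.cosetGraph (L i.1)).Vertex)
      (β β' : ∀ i : {i : ℕ // j₀ ≤ i}, (P.cosetGraph (L i.1)).Branch),
      (∀ i, β i ≠ β' i ∧ (P.cosetGraph (L i.1)).abuts (β i) = some (w i) ∧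
        (P.cosetGraph (L i.1)).abuts (β' i) = some (w i)) →
      (∀ ⦃i i' : {i : ℕ // j₀ ≤ i}⦄ (h : i.1 ≤ i'.1),
        (P.cosetGraphTrans (hLanti h)).vertexMap (w i') = w i ∧
        (P.cosetGraphTrans (hLanti h)).branchMap (β i') = β i ∧
          (P.cosetGraphTrans (hLanti h)).branchMap (β' i') = β' i) →
      (∀ (i : {i : ℕ // j₀ ≤ i}) (γ : C),
        (P.arithAct hP (L i.1) (hLst i.1) (ι γ)).hom.vertexMap (w i) = w i ∧
        (P.arithAct hP (L i.1) (hLst i.1) (ι γ)).hom.branchMap (β i) = β i ∧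
          (P.arithAct hP (L i.1) (hLst i.1) (ι γ)).hom.branchMap (β' i) = β' i) →
        C = ⊥)
    {v : 𝔾.Vertex} {b b' : 𝔾.Branch} (hb : 𝔾.abuts b = some v) (hb' : 𝔾.abuts b' = some v)
    (hbb' : b ≠ b') :
    ∀ C : Subgroup Γ, IsCompact (C : Set Γ) → (∀ n (t : C), P.deckAct (L n) (t : Γ) = 1) → C = ⊥ :=
  P.eq_bot_of_isCompact_of_forall_deckAct_eq_one L hLanti hP hLst ι hιΦ hισ hnobpNCpt 0
    (fun i => P.vMk (L i.1) v 1) (fun i => P.bMk (L i.1) b (P.s b)⁻¹) (fun i => P.bMk (L i.1) b' (P.s b')⁻¹)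
    (fun i => ⟨fun h => hbb' (congrArg (fun p : (P.cosetGraph (L i.1)).Branch => p.1.1) h),
      by rw [P.cosetGraph_abuts_bMk (L i.1) b v hb, mul_inv_cancel],
      by rw [P.cosetGraph_abuts_bMk (L i.1) b' v hb', mul_inv_cancel]⟩)
    (fun _ _ _ => ⟨rfl, rfl, rfl⟩)

end SubgroupPresentation

end SemiGraph

namespace ProfiniteSemiGraph

namespace GaloisLevelData

open Literature.AnabelianGeometry.EtaleTheta
open Literature.AnabelianGeometry.AbsoluteAnabelian (IsTopologicallyFinitelyGenerated)

variable {𝒢 : ProfiniteSemiGraph.{u}} (D : GaloisLevelData 𝒢) (h𝒢 : 𝒢.IsCountable)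
  (hcof : ∀ (T : CovObj 𝒢), T.IsTempered → ∀ p : T.Point,
    ∃ i : ℕ, ∀ j, i ≤ j → (D.S j).Splits (T.component p))
  (hcn : 𝒢.graph.IsConnected) (hS : ∀ n, (D.S n).Splits (D.S n)) (hfin : ∀ n, (D.S n).IsFinite)
  (hne : ∀ n, (D.S n).HasNonemptyFibres)
  (hconn : ∀ (n : ℕ) (p q : (D.S n).Point), (D.S n).SameComponent p q)
  (T : ∀ w : 𝒢.graph.Vertex, D.PointSeq h𝒢 w) (R : SemiGraph.RefBranches 𝒢.graph)

/-- **«hUρ» at the chart of a cofinal Galois tower with characteristic, vertex-faithful levels, for `𝒢`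
with a vertex carrying two distinct branches** — `mem_ker_of_mem_iInf_map_ker_arithAct_chart_outerAction`
with `hnobpNCpt :=` abc-iut-w4-d053's `hnobpNCpt_cosetTower_of_faithV_chart` (from (I0v) `hfaithV` of the
tower, Thm 3.7 (i)) and the branch-pair system of
`eq_bot_of_isCompact_of_forall_deckAct_eq_one_of_two_branches`: the residual inputs are the characteristic
levels `hker` (`d` unbounded), (I0v) `hfaithV`, Φ-stability `hN`, compatibility `hP`, and the two branches.
[cite: MochizukiSemiAnbd2006, Thm 5.4 (i) p.66] -/
theorem mem_ker_of_mem_iInf_map_ker_arithAct_chart_outerAction_of_two_branches (h37 : 𝒢.Thm37Hypotheses)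
    {PA : Type u} [Group PA] (ρ' : PA →* TopOut (D.chart h𝒢 hcof hcn hS hfin hne).G)
    (baseAct : PA →* Aut 𝒢.graph)
    (hP : (D.piPresentation h𝒢 T R).IsArithCompatible
      (((contMulAut (D.chart h𝒢 hcof hcn hS hfin hne).G).subtype.comp
        (MonoidHom.fst (contMulAut (D.chart h𝒢 hcof hcn hS hfin hne).G) PA)).comp
          (outerSemidirectProduct ρ').subtype)
      (baseAct.comp (outerSemidirectProductSnd ρ')))
    (hN : ∀ (n : ℕ) (e : outerSemidirectProduct ρ') (x : (D.chart h𝒢 hcof hcn hS hfin hne).G),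
      x ∈ (D.piLevelAut h𝒢 hconn n).ker →
        (((contMulAut (D.chart h𝒢 hcof hcn hS hfin hne).G).subtype.comp
          (MonoidHom.fst (contMulAut (D.chart h𝒢 hcof hcn hS hfin hne).G) PA)).comp
            (outerSemidirectProduct ρ').subtype) e x ∈ (D.piLevelAut h𝒢 hconn n).ker)
    (d : ℕ → ℕ) (hker : ∀ n, (D.piLevelAut h𝒢 hconn n).ker = charOpenCore (D.temperedPi h𝒢) (d n))
    (hd : ∀ m : ℕ, ∃ n, m ≤ d n)
    (hfaithV : ∀ (v : 𝒢.graph.Vertex) (h : 𝒢.Gv v),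
      (∀ (n : ℕ) (x : ((D.S n).SV v).obj.V), ((D.S n).SV v).obj.ρ h x = x) → h = 1)
    {v : 𝒢.graph.Vertex} {b b' : 𝒢.graph.Branch} (hb : 𝒢.graph.abuts b = some v)
    (hb' : 𝒢.graph.abuts b' = some v) (hbb' : b ≠ b')
    {a : PA} (ha : ∀ n, a ∈ (((D.piPresentation h𝒢 T R).arithAct hP (D.piLevelAut h𝒢 hconn n).ker
      (hN n)).ker).map (outerSemidirectProductSnd ρ')) :
    a ∈ ρ'.ker := by
  haveI hLn : ∀ n : ℕ, @Subgroup.Normal (D.chart h𝒢 hcof hcn hS hfin hne).G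
      (D.chart h𝒢 hcof hcn hS hfin hne).group ((D.piLevelAut h𝒢 hconn n).ker) :=
    fun _ => MonoidHom.normal_ker _
  have hex : (toOuterSemidirectProduct ρ').range = (outerSemidirectProductSnd ρ').ker :=
    range_toOuterSemidirectProduct_eq_ker ρ'
  have hισ : ∀ g : (D.chart h𝒢 hcof hcn hS hfin hne).G,
      (baseAct.comp (outerSemidirectProductSnd ρ')) ((toOuterSemidirectProduct ρ') g) = 1 := fun g => by
    have hg : (toOuterSemidirectProduct ρ') g ∈ (outerSemidirectProductSnd ρ').ker := hex ▸ ⟨g, rfl⟩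
    rw [MonoidHom.comp_apply, (MonoidHom.mem_ker).mp hg, map_one]
  have hnobpNCpt := hnobpNCpt_cosetTower_of_faithV_chart D h𝒢 hcof hcn hS hfin hne hconn T R h37 hP hN
    (toOuterSemidirectProduct ρ') (fun _ => rfl) hισ hfaithV
  exact D.mem_ker_of_mem_iInf_map_ker_arithAct_chart_outerAction h𝒢 hcof hcn hS hfin hne hconn T R
    h37.toProp36Hypotheses ρ' baseAct hP hN d hker hd hnobpNCpt 0
    (fun i => (D.piPresentation h𝒢 T R).vMk (D.piLevelAut h𝒢 hconn i.1).ker v 1)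
    (fun i => (D.piPresentation h𝒢 T R).bMk (D.piLevelAut h𝒢 hconn i.1).ker b
      ((D.piPresentation h𝒢 T R).s b)⁻¹)
    (fun i => (D.piPresentation h𝒢 T R).bMk (D.piLevelAut h𝒢 hconn i.1).ker b'
      ((D.piPresentation h𝒢 T R).s b')⁻¹)
    (fun i => ⟨fun h => hbb' (congrArg
        (fun p : ((D.piPresentation h𝒢 T R).cosetGraph (D.piLevelAut h𝒢 hconn i.1).ker).Branch => p.1.1) h),
      by rw [(D.piPresentation h𝒢 T R).cosetGraph_abuts_bMk _ b v hb, mul_inv_cancel],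
      by rw [(D.piPresentation h𝒢 T R).cosetGraph_abuts_bMk _ b' v hb', mul_inv_cancel]⟩)
    (fun _ _ _ => ⟨rfl, rfl, rfl⟩) ha

/-- **«hUρ» AT THE CHARACTERISTIC TOWER — every tower input a term.** For a finite semi-graph of anabelioids
`𝒢` with topologically finitely generated constituents, satisfying the hypotheses of Thm 3.7 and having a
vertex with two distinct abutting branches, at `E := π₁^temp(𝒢) ⋊^out_{ρ′} Π_A` over the chart of
abc-iut-w4-d048's characteristic tower `GaloisLevelData.ofCharCores h36 v₀ hVt hEt`: every `a ∈ Π_A`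
admitting at every finite level `ker π_k` a lift acting trivially on that level's coset semi-graph has
`ρ′ a = 1`.  Inputs by name: `hker := ofCharCores_ker_piLevelAut_eq_charOpenCore` (abc-iut-w4-d029),
`hfaithV := faithfulV_ofCharCores` (abc-iut-w4-d053), `hR`/`hnobp` of this file; residual = the
compatibility/stability binders `hP`/`hN` of the presentation (terms of record at the design data:
`isArithCompatible_piPresentation_outerAction_of_branchPair_chart_of_finite`,
`hKst_and_hLst_of_ker_piLevelAut_eq_charOpenCore … .2`). [cite: MochizukiSemiAnbd2006, Thm 5.4 (i) p.66] -/
theorem ofCharCores_mem_ker_of_mem_iInf_map_ker_arithAct_outerAction [Finite 𝒢.graph.Vertex]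
    [Finite 𝒢.graph.Branch] (h37 : 𝒢.Thm37Hypotheses) (v₀ : 𝒢.graph.Vertex)
    (hVt : ∀ v : 𝒢.graph.Vertex, IsTopologicallyFinitelyGenerated (𝒢.Gv v))
    (hEt : ∀ e : 𝒢.graph.Edge, IsTopologicallyFinitelyGenerated (𝒢.Ge e))
    (T : ∀ w : 𝒢.graph.Vertex, (GaloisLevelData.ofCharCores h37.toProp36Hypotheses v₀ hVt hEt).PointSeq h37.toProp36Hypotheses.isCountable w)
    (R : SemiGraph.RefBranches 𝒢.graph)
    {PA : Type u} [Group PA] (ρ' : PA →* TopOut ((GaloisLevelData.ofCharCores h37.toProp36Hypotheses v₀ hVt hEt).chart h37.toProp36Hypotheses.isCountable (ofCharCores_exists_level_splits_component h37.toProp36Hypotheses v₀ hVt hEt) h37.toProp36Hypotheses.isConnected (ofCharCores_splits_self h37.toProp36Hypotheses v₀ hVt hEt) (ofCharCores_isFinite h37.toProp36Hypotheses v₀ hVt hEt) (ofCharCores_hasNonemptyFibres h37.toProp36Hypotheses v₀ hVt hEt)).G) (baseAct : PA →* Aut 𝒢.graph)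
    (hP : ((GaloisLevelData.ofCharCores h37.toProp36Hypotheses v₀ hVt hEt).piPresentation h37.toProp36Hypotheses.isCountable T R).IsArithCompatible (((contMulAut ((GaloisLevelData.ofCharCores h37.toProp36Hypotheses v₀ hVt hEt).chart h37.toProp36Hypotheses.isCountable (ofCharCores_exists_level_splits_component h37.toProp36Hypotheses v₀ hVt hEt) h37.toProp36Hypotheses.isConnected (ofCharCores_splits_self h37.toProp36Hypotheses v₀ hVt hEt) (ofCharCores_isFinite h37.toProp36Hypotheses v₀ hVt hEt) (ofCharCores_hasNonemptyFibres h37.toProp36Hypotheses v₀ hVt hEt)).G).subtype.comp (MonoidHom.fst (contMulAut ((GaloisLevelData.ofCharCores h37.toProp36Hypotheses v₀ hVt hEt).chart h37.toProp36Hypotheses.isCountable (ofCharCores_exists_level_splits_component h37.toProp36Hypotheses v₀ hVt hEt) h37.toProp36Hypotheses.isConnected (ofCharCores_splits_self h37.toProp36Hypotheses v₀ hVt hEt) (ofCharCores_isFinite h37.toProp36Hypotheses v₀ hVt hEt) (ofCharCores_hasNonemptyFibres h37.toProp36Hypotheses v₀ hVt hEt)).G) PA)).comp (outerSemidirectProduct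 ρ').subtype) (baseAct.comp (outerSemidirectProductSnd ρ')))
    (hN : ∀ (n : ℕ) (e : outerSemidirectProduct ρ') (x : ((GaloisLevelData.ofCharCores h37.toProp36Hypotheses v₀ hVt hEt).chart h37.toProp36Hypotheses.isCountable (ofCharCores_exists_level_splits_component h37.toProp36Hypotheses v₀ hVt hEt) h37.toProp36Hypotheses.isConnected (ofCharCores_splits_self h37.toProp36Hypotheses v₀ hVt hEt) (ofCharCores_isFinite h37.toProp36Hypotheses v₀ hVt hEt) (ofCharCores_hasNonemptyFibres h37.toProp36Hypotheses v₀ hVt hEt)).G), x ∈ ((GaloisLevelData.ofCharCores h37.toProp36Hypotheses v₀ hVt hEt).piLevelAut h37.toProp36Hypotheses.isCountable (ofCharCores_sameComponent h37.toProp36Hypotheses v₀ hVt hEt) n).ker →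
      (((contMulAut ((GaloisLevelData.ofCharCores h37.toProp36Hypotheses v₀ hVt hEt).chart h37.toProp36Hypotheses.isCountable (ofCharCores_exists_level_splits_component h37.toProp36Hypotheses v₀ hVt hEt) h37.toProp36Hypotheses.isConnected (ofCharCores_splits_self h37.toProp36Hypotheses v₀ hVt hEt) (ofCharCores_isFinite h37.toProp36Hypotheses v₀ hVt hEt) (ofCharCores_hasNonemptyFibres h37.toProp36Hypotheses v₀ hVt hEt)).G).subtype.comp (MonoidHom.fst (contMulAut ((GaloisLevelData.ofCharCores h37.toProp36Hypotheses v₀ hVt hEt).chart h37.toProp36Hypotheses.isCountable (ofCharCores_exists_level_splits_component h37.toProp36Hypotheses v₀ hVt hEt) h37.toProp36Hypotheses.isConnected (ofCharCores_splits_self h37.toProp36Hypotheses v₀ hVt hEt) (ofCharCores_isFinite h37.toProp36Hypotheses v₀ hVt hEt) (ofCharCores_hasNonemptyFibres h37.toProp36Hypotheses v₀ hVt hEt)).G) PA)).comp (outerSemidirectProduct ρ').subtype) e x ∈ ((GaloisLevelData.ofCharCores h37.toProp36Hypotheses v₀ hVt hEt).piLevelAut h37.toProp36Hypotheses.isCountable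 (ofCharCores_sameComponent h37.toProp36Hypotheses v₀ hVt hEt) n).ker)
    {v : 𝒢.graph.Vertex} {b b' : 𝒢.graph.Branch} (hb : 𝒢.graph.abuts b = some v)
    (hb' : 𝒢.graph.abuts b' = some v) (hbb' : b ≠ b')
    {a : PA} (ha : ∀ n, a ∈ ((((GaloisLevelData.ofCharCores h37.toProp36Hypotheses v₀ hVt hEt).piPresentation h37.toProp36Hypotheses.isCountable T R).arithAct hP ((GaloisLevelData.ofCharCores h37.toProp36Hypotheses v₀ hVt hEt).piLevelAut h37.toProp36Hypotheses.isCountable (ofCharCores_sameComponent h37.toProp36Hypotheses v₀ hVt hEt) n).ker (hN n)).ker).map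
      (outerSemidirectProductSnd ρ')) :
    a ∈ ρ'.ker :=
  (GaloisLevelData.ofCharCores h37.toProp36Hypotheses v₀ hVt hEt).mem_ker_of_mem_iInf_map_ker_arithAct_chart_outerAction_of_two_branches
    h37.toProp36Hypotheses.isCountable (ofCharCores_exists_level_splits_component h37.toProp36Hypotheses v₀ hVt hEt)
    h37.toProp36Hypotheses.isConnected (ofCharCores_splits_self h37.toProp36Hypotheses v₀ hVt hEt)
    (ofCharCores_isFinite h37.toProp36Hypotheses v₀ hVt hEt) (ofCharCores_hasNonemptyFibres h37.toProp36Hypotheses v₀ hVt hEt)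
    (ofCharCores_sameComponent h37.toProp36Hypotheses v₀ hVt hEt) T R h37 ρ' baseAct hP hN (fun k : ℕ => k)
    (ofCharCores_ker_piLevelAut_eq_charOpenCore h37.toProp36Hypotheses v₀ hVt hEt) (fun m => ⟨m, le_rfl⟩)
    (faithfulV_ofCharCores v₀ h37 hVt hEt) hb hb' hbb' ha

end GaloisLevelData

end ProfiniteSemiGraph

end Literature.AnabelianGeometry.SemiGraphs
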